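import Literature.Probability.RandomGraphs.PlantedCliqueProgram
import Mathlib.Algebra.BigOperators.Fin
import Mathlib.Data.Matrix.Mul
import HarnessLib

/-!
# The AKS program: the edge string and the power iteration

Two pieces of semantics of the functional program `AKSProg` (`PlantedCliqueProgram.lean`):

* `adj_encodeEdgeVec` — the program's adjacency test `adj n w i j` on the edge string
  `w = encodeEdgeVec x` IS adjacency in the graph `graphOfEdgeVec x` (the lexicographic layout of
  `encodeEdgeVec`: row `i` starts at `rowOffset n i = Σ_{i'<i} (n - 1 - i')` and lists the pairs
  `(i, i+1), …, (i, n-1)`);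
* `powerCol_getD` — `powerCol n w L j t` is column `j` of the `t`-th power of the integer matrix
  `(a, b) ↦ sgnEntry n w L[a] L[b]` on the positions of the vertex list `L` (exact power
  iteration, AKS 1998 §2.1 step 1 in integer arithmetic), and `length_powerCol`.

## References

* N. Alon, M. Krivelevich, B. Sudakov, *Finding a large hidden clique in a random graph*, Random
  Structures Algorithms 13 (1998) 457–466, §2.1 [AlonKrivelevichSudakov1998].
-/

namespace Literature.Probability.RandomGraphs.PlantedClique

namespace AKSProg

open List Finset

/-! ### Indexing into a `flatMap` -/

/-- Position `offset(m) + t` of `L.flatMap f` is position `t` of the `m`-th block. [folklore] -/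
theorem getD_flatMap_block {α β : Type*} (f : α → List β) (d : β) :
    ∀ (L : List α) (m : ℕ) (hm : m < L.length) (t : ℕ), t < (f (L[m]'hm)).length →
      (L.flatMap f).getD (((L.take m).map fun a => (f a).length).sum + t) d = (f (L[m]'hm)).getD t d
  | [], m, hm, t, _ => absurd hm (Nat.not_lt_zero _)
  | a :: L, 0, _, t, ht => by
    rw [List.take_zero, List.map_nil, List.sum_nil, Nat.zero_add, List.flatMap_cons]
    exact List.getD_append _ _ _ _ ht
  | a :: L, m + 1, hm, t, ht => by
    rw [List.take_succ_cons, List.map_cons, List.sum_cons, List.flatMap_cons, Nat.add_assoc,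
      List.getD_append_right _ _ _ _ (Nat.le_add_right _ _), Nat.add_sub_cancel_left]
    exact getD_flatMap_block f d L m (by simpa using hm) t ht

/-- `filterMap` of a guarded `some` is `map` after `filter`. [folklore] -/
theorem filterMap_ite_some {α β : Type*} (p : α → Prop) [DecidablePred p] (g : α → β) :
    ∀ l : List α, l.filterMap (fun a => if p a then some (g a) else none) = (l.filter fun a => p a).map g
  | [] => rfl
  | a :: l => by
    rw [List.filterMap_cons, List.filter_cons]
    by_cases h : p a
    · simp [h, filterMap_ite_some p g l]
    · simp [h, filterMap_ite_some p g l]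

/-! ### The rows of the edge string -/

section Rows

variable {n : ℕ}

/-- The bits of the edges out of `i` to larger vertices, as a total table. [folklore] -/
def edgeBit (x : EdgeVec n) (i j : Fin n) : Bool :=
  if h : i < j then x ⟨s(i, j), by simp [h.ne]⟩ else false

/-- Row `i` of the edge string. [folklore] -/
def row (x : EdgeVec n) (i : Fin n) : List Bool :=
  (List.finRange n).filterMap fun j => if h : i < j then some (x ⟨s(i, j), by simp [h.ne]⟩) else none

/-- `encodeEdgeVec` is the concatenation of its rows. [folklore] -/
theorem encodeEdgeVec_eq_flatMap_row (x : EdgeVec n) :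
    encodeEdgeVec x = (List.finRange n).flatMap (row x) := rfl

/-- The elements of `finRange n` past position `i` are exactly those `> i`. [folklore] -/
theorem filter_lt_finRange (i : Fin n) :
    (List.finRange n).filter (fun j => decide (i < j)) = (List.finRange n).drop (i + 1) := by
  conv_lhs => rw [← List.take_append_drop (i + 1) (List.finRange n)]
  rw [List.filter_append]
  have h1 : ((List.finRange n).take (i + 1)).filter (fun j => decide (i < j)) = [] := by
    rw [List.filter_eq_nil_iff]
    intro j hj
    obtain ⟨t, ht, rfl⟩ := List.mem_iff_getElem.1 hj
    rw [List.getElem_take, List.getElem_finRange]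
    simp only [decide_eq_true_eq, not_lt]
    rw [List.length_take] at ht
    change t ≤ (i : ℕ)
    omega
  have h2 : ((List.finRange n).drop (i + 1)).filter (fun j => decide (i < j)) =
      (List.finRange n).drop (i + 1) := by
    rw [List.filter_eq_self]
    intro j hj
    obtain ⟨t, ht, rfl⟩ := List.mem_iff_getElem.1 hj
    rw [List.getElem_drop, List.getElem_finRange]
    simp only [decide_eq_true_eq]
    change (i : ℕ) < i + 1 + t
    omega
  rw [h1, h2, List.nil_append]

/-- Row `i` lists `edgeBit x i j` for `j = i+1, …, n-1`. [folklore] -/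
theorem row_eq_map_drop (x : EdgeVec n) (i : Fin n) :
    row x i = ((List.finRange n).drop (i + 1)).map (edgeBit x i) := by
  have hfun : (fun j : Fin n => if h : i < j then some (x ⟨s(i, j), by simp [h.ne]⟩) else none) =
      fun j => if i < j then some (edgeBit x i j) else none := by
    funext j
    by_cases h : i < j
    · rw [dif_pos h, if_pos h, edgeBit, dif_pos h]
    · rw [dif_neg h, if_neg h]
  rw [row, hfun, filterMap_ite_some, filter_lt_finRange]

/-- Row `i` has `n - 1 - i` bits. [folklore] -/
theorem length_row (x : EdgeVec n) (i : Fin n) : (row x i).length = n - 1 - i := by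
  rw [row_eq_map_drop, List.length_map, List.length_drop, List.length_finRange]
  omega

/-- Bit `t` of row `i` is the edge `{i, i+1+t}`. [folklore] -/
theorem getD_row (x : EdgeVec n) (i j : Fin n) (hij : i < j) :
    (row x i).getD (j - i - 1) false = x ⟨s(i, j), by simp [hij.ne]⟩ := by
  have hij' : (i : ℕ) < j := hij
  have hlt : (j : ℕ) - i - 1 < ((List.finRange n).drop (i + 1)).length := by
    rw [List.length_drop, List.length_finRange]
    have := j.isLt
    omega
  rw [row_eq_map_drop, List.getD_eq_getElem _ _ (by rw [List.length_map]; exact hlt),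
    List.getElem_map, List.getElem_drop, List.getElem_finRange]
  have hj : (Fin.cast List.length_finRange ⟨(i : ℕ) + 1 + (j - i - 1), by
      rw [List.length_finRange]; have := j.isLt; omega⟩ : Fin n) = j := by
    ext; simp only [Fin.val_cast]; omega
  rw [hj, edgeBit, dif_pos hij]

/-- The offset of row `i` in the edge string is `rowOffset n i`. [folklore] -/
theorem sum_length_row_take (x : EdgeVec n) (i : Fin n) :
    (((List.finRange n).take i).map fun a => (row x a).length).sum = rowOffset n i := by
  rw [rowOffset]
  congr 1
  apply List.ext_getElem
  · rw [List.length_map, List.length_map, List.length_take, List.length_finRange,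
      List.length_range, min_eq_left i.isLt.le]
  · intro t h1 h2
    rw [List.getElem_map, List.getElem_map, List.getElem_range, List.getElem_take,
      List.getElem_finRange, length_row]
    rfl

/-- **The adjacency test of the program reads the right bit**: for `i < j`,
`(encodeEdgeVec x)[rowOffset n i + (j - i - 1)]` is the indicator of the edge `{i, j}`.
[folklore] -/
theorem getD_encodeEdgeVec (x : EdgeVec n) (i j : Fin n) (hij : i < j) :
    (encodeEdgeVec x).getD (rowOffset n i + (j - i - 1)) false = x ⟨s(i, j), by simp [hij.ne]⟩ := by
  have hi : (i : ℕ) < (List.finRange n).length := by rw [List.length_finRange]; exact i.isLt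
  have hrow : row x ((List.finRange n)[(i : ℕ)]'hi) = row x i := by
    rw [List.getElem_finRange]; congr 1
  have ht : (j : ℕ) - i - 1 < (row x ((List.finRange n)[(i : ℕ)]'hi)).length := by
    have hij' : (i : ℕ) < j := hij
    rw [hrow, length_row]; have := j.isLt; omega
  have h := getD_flatMap_block (row x) false (List.finRange n) i hi (j - i - 1) ht
  rw [hrow, sum_length_row_take, getD_row x i j hij] at h
  rw [encodeEdgeVec_eq_flatMap_row]
  exact h

/-- **`adj` is adjacency.** On the edge string of `x`, the program's `adj n w i j` is the
adjacency of `i` and `j` in `graphOfEdgeVec x`. [folklore] -/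
theorem adj_encodeEdgeVec (x : EdgeVec n) (i j : Fin n) :
    adj n (encodeEdgeVec x) i j = true ↔ (graphOfEdgeVec x).Adj i j := by
  rw [graphOfEdgeVec_adj]
  rcases lt_trichotomy i j with h | h | h
  · rw [adj, if_pos (show (i : ℕ) < j from h), getD_encodeEdgeVec x i j h]
    exact ⟨fun hx => ⟨h.ne, hx⟩, fun ⟨_, hx⟩ => hx⟩
  · subst h
    rw [adj, if_neg (lt_irrefl _), if_neg (lt_irrefl _)]
    simp
  · rw [adj, if_neg (show ¬ (i : ℕ) < j from not_lt.2 (Fin.le_def.1 h.le)),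
      if_pos (show (j : ℕ) < i from h), getD_encodeEdgeVec x j i h]
    have hs : (⟨s((j : Fin n), i), by simp [h.ne]⟩ : (⊤ : SimpleGraph (Fin n)).edgeSet) =
        ⟨s(i, j), by simp [h.ne']⟩ := Subtype.ext (Sym2.eq_swap)
    rw [hs]
    exact ⟨fun hx => ⟨h.ne', hx⟩, fun ⟨_, hx⟩ => hx⟩

/-- Natural-number form: for `i, j < n`, `adj n (encodeEdgeVec x) i j` is adjacency of `⟨i⟩, ⟨j⟩`.
[folklore] -/
theorem adj_encodeEdgeVec_nat (x : EdgeVec n) {i j : ℕ} (hi : i < n) (hj : j < n) :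
    adj n (encodeEdgeVec x) i j = true ↔ (graphOfEdgeVec x).Adj ⟨i, hi⟩ ⟨j, hj⟩ :=
  adj_encodeEdgeVec x ⟨i, hi⟩ ⟨j, hj⟩

end Rows

/-! ### The power iteration -/

section Power

variable (n : ℕ) (w : List Bool) (L : List ℕ)

/-- `matVec` preserves the length of the vertex list. [folklore] -/
theorem length_matVec (y : List ℤ) : (matVec n w L y).length = L.length := by
  rw [matVec, List.length_map]

/-- The sum of a mapped list as a sum over positions. [folklore] -/
theorem sum_map_eq_sum_range {α : Type*} (l : List α) (g : α → ℤ) (d : α) :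
    (l.map g).sum = ∑ b ∈ Finset.range l.length, g (l.getD b d) := by
  rw [← List.ofFn_getElem_eq_map, List.sum_ofFn, ← Fin.sum_univ_eq_sum_range]
  refine Finset.sum_congr rfl fun b _ => ?_
  rw [List.getD_eq_getElem _ _ b.isLt]

/-- Coordinates of one round: `(B_L y)_a = Σ_b sgnEntry(L a, L b) · y_b`. [folklore] -/
theorem matVec_getD (y : List ℤ) (hy : y.length = L.length) {a : ℕ} (ha : a < L.length) :
    (matVec n w L y).getD a 0 =
      ∑ b ∈ Finset.range L.length, sgnEntry n w (L.getD a 0) (L.getD b 0) * y.getD b 0 := by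
  rw [matVec, List.getD_eq_getElem _ _ (by rw [List.length_map]; exact ha), List.getElem_map,
    sum_map_eq_sum_range _ _ ((0 : ℕ), (0 : ℤ)), List.getD_eq_getElem L 0 ha]
  have hlen : (L.zip y).length = L.length := by rw [List.length_zip, hy, min_self]
  rw [hlen]
  refine Finset.sum_congr rfl fun b hb => ?_
  rw [Finset.mem_range] at hb
  have hb' : b < (L.zip y).length := by rw [hlen]; exact hb
  have hby : b < y.length := by rw [hy]; exact hb
  rw [List.getD_eq_getElem (L.zip y) _ hb', List.getElem_zip, List.getD_eq_getElem L 0 hb,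
    List.getD_eq_getElem y 0 hby]

/-- A fold over `range t` with a constant step is iteration. [folklore] -/
theorem foldl_range_const {α : Type*} (F : α → α) (a : α) :
    ∀ t : ℕ, (List.range t).foldl (fun y _ => F y) a = F^[t] a
  | 0 => rfl
  | t + 1 => by
    rw [List.range_succ, List.foldl_append, foldl_range_const F a t, List.foldl_cons,
      List.foldl_nil, Function.iterate_succ_apply']

/-- `powerCol` is iterated `matVec` from the basis vector. [folklore] -/
theorem powerCol_eq_iterate (j t : ℕ) :
    powerCol n w L j t = (matVec n w L)^[t] (basisVec L.length j) :=
  foldl_range_const _ _ t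

/-- The matrix `B_L` of the power iteration on `m` positions of `L` (intended `m = |L|`).
[folklore] -/
def posMatrix (m : ℕ) : Matrix (Fin m) (Fin m) ℤ :=
  Matrix.of fun a b => sgnEntry n w (L.getD a 0) (L.getD b 0)

/-- `powerCol n w L j t` has length `|L|`. [folklore] -/
theorem length_powerCol (j : ℕ) : ∀ t : ℕ, (powerCol n w L j t).length = L.length
  | 0 => by rw [powerCol_eq_iterate, Function.iterate_zero_apply, basisVec, List.length_map,
      List.length_range]
  | t + 1 => by rw [powerCol_eq_iterate, Function.iterate_succ_apply', length_matVec]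

/-- **`powerCol` is a column of the matrix power**: for `j, a < m = |L|`,
`(powerCol n w L j t)_a = (B_Lᵗ)_{a j}`. [cite: AlonKrivelevichSudakov1998, §2.1 (step 1)] -/
theorem powerCol_getD {m : ℕ} (hm : L.length = m) {j : ℕ} (hj : j < m) :
    ∀ (t : ℕ) {a : ℕ} (ha : a < m),
      (powerCol n w L j t).getD a 0 = (posMatrix n w L m ^ t) ⟨a, ha⟩ ⟨j, hj⟩
  | 0, a, ha => by
    rw [powerCol_eq_iterate, Function.iterate_zero_apply, basisVec, pow_zero,
      List.getD_eq_getElem _ _ (by rw [List.length_map, List.length_range, hm]; exact ha),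
      List.getElem_map, List.getElem_range, Matrix.one_apply]
    simp only [Fin.mk.injEq]
  | t + 1, a, ha => by
    have hlen : ((matVec n w L)^[t] (basisVec L.length j)).length = L.length := by
      rw [← powerCol_eq_iterate]; exact length_powerCol n w L j t
    rw [powerCol_eq_iterate, Function.iterate_succ_apply',
      matVec_getD n w L _ hlen (by rw [hm]; exact ha), hm, pow_succ', Matrix.mul_apply,
      Finset.sum_range]
    refine Finset.sum_congr rfl fun b _ => ?_
    have ih := powerCol_getD hm hj t b.isLt
    rw [powerCol_eq_iterate, hm, Fin.eta] at ih
    rw [ih, posMatrix, Matrix.of_apply]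

end Power

end AKSProg

end Literature.Probability.RandomGraphs.PlantedClique
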